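import Mathlib
import Literature.Analysis.FluidPDE.NSVorticityBKMHolds
import Literature.Analysis.FluidPDE.TaoLocalisationHolds
import Summits.NavierStokesRegularity.NavierStokesRegularity.Theses.CoreLogGas

/-!
# Route CoreLogGas — `CoreReductionContinuation` (item stmt-NavierStokesRegularity-2090), proved

The support statement `CoreReductionContinuation` of route CoreLogGas: a classical solution of the
unforced Navier–Stokes system on `ℝ³ × [0, T)` which is Leray–Hopf from its rapidly decaying datum
and whose vorticity is dominated on `[t₀, T)` by `K · sup_s κ / A(t, s)` for a `C¹`, `L`-periodic
log-gas pair `(A, w)` with bounded mass / momentum residuals, extends smoothly past `T`.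

## Proof

1. **No vacuum from the mass residual alone** (`coreLogGas_area_lower_bound`). Since `A`, `w` are
   `C¹` on all of `ℝ²` and `L`-periodic in `s`, `∂ₛw` is bounded by some `W` on
   `[t₀, T] × [0, L]`. The period minimum `m(t) = min_s A(t, s)` is continuous, and at a minimiser
   `s₁` of `A(t, ·)` one has `∂ₛA(t, s₁) = 0`, so the mass residual
   `|∂ₜA + ∂ₛA·w + A·∂ₛw| ≤ S·A` gives `-∂ₜA(t, s₁) ≤ (|S| + W) A(t, s₁)`. A time-reversed
   Dini–Grönwall argument (Mathlib `le_gronwallBound_of_liminf_deriv_right_le` applied to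
   `τ ↦ m(t₁ - τ)`) yields `m(t) ≥ m(t₀) e^{-(|S|+W)(t-t₀)}`, hence a uniform positive lower bound
   `a₀` for `A` on `[t₀, T) × ℝ`, and `‖curl u(t, x)‖ ≤ |K| κ / a₀` there.
2. **Continuation by Beale–Kato–Majda.** By Tao 2013 (`tao2011_hasBoundedSobolevNormsOn_holds`) the
   solution lies in the BKM class on every closed slab `[0, T₁]`, `T₁ < T`; by the Sobolev
   imbedding (`exists_enorm_curl_le_of_hasBoundedSobolevNormsOn`) its vorticity is bounded on
   `[0, t₁]`, `t₁ = max t₀ (T/2)`; with step 1 the BKM integral `∫₀ᵀ ‖curl u(t)‖_∞ dt` is finite,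
   so the discharged criterion `beale_kato_majda_holds` continues the solution in the class past `T`,
   in particular smoothly (`HasSobolevExtensionPast.hasSmoothExtensionPast`).

No named fact is assumed: every ingredient is a theorem of the tree.
-/

noncomputable section

open MeasureTheory Set Function Filter Topology
open scoped ENNReal NNReal

-- the summit and its single sub-problem share the name (CONVENTIONS §1), as in every Theorems file
set_option linter.dupNamespace false

namespace Summit.NavierStokesRegularity.NavierStokesRegularity.Theorems

open Literature.Analysis.FluidPDE

/-- Partial derivative in the first variable of a `C¹` function of two real variables, as a
`HasDerivAt` statement for the slice `τ ↦ A τ s` (chain rule with `τ ↦ (τ, s)`). -/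
theorem coreLogGas_hasDerivAt_fst {A : ℝ → ℝ → ℝ} (hA : ContDiff ℝ 1 (uncurry A)) (t s : ℝ) :
    HasDerivAt (fun τ => A τ s) (fderiv ℝ (uncurry A) (t, s) (1, 0)) t := by
  have h1 : HasFDerivAt (uncurry A) (fderiv ℝ (uncurry A) (t, s)) (t, s) :=
    (hA.differentiable one_ne_zero (t, s)).hasFDerivAt
  have h2 : HasDerivAt (fun τ : ℝ => (τ, s)) ((1 : ℝ), (0 : ℝ)) t :=
    (hasDerivAt_id t).prodMk (hasDerivAt_const t s)
  exact h1.comp_hasDerivAt t h2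

/-- Partial derivative in the second variable of a `C¹` function of two real variables, as a
`HasDerivAt` statement for the slice `y ↦ A t y` (chain rule with `y ↦ (t, y)`). -/
theorem coreLogGas_hasDerivAt_snd {A : ℝ → ℝ → ℝ} (hA : ContDiff ℝ 1 (uncurry A)) (t s : ℝ) :
    HasDerivAt (fun y => A t y) (fderiv ℝ (uncurry A) (t, s) (0, 1)) s := by
  have h1 : HasFDerivAt (uncurry A) (fderiv ℝ (uncurry A) (t, s)) (t, s) :=
    (hA.differentiable one_ne_zero (t, s)).hasFDerivAt
  have h2 : HasDerivAt (fun y : ℝ => (t, y)) ((0 : ℝ), (1 : ℝ)) s :=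
    (hasDerivAt_const s t).prodMk (hasDerivAt_id s)
  exact h1.comp_hasDerivAt s h2

/-- **No vacuum for the core log-gas from the mass residual alone.** Let `A`, `w` be `C¹` on `ℝ²`,
`A(t, ·)` `L`-periodic, `A > 0` on `[t₀, T) × ℝ`, and suppose the mass residual bound
`|∂ₜA + ∂ₛA·w + A·∂ₛw| ≤ S·A` on `[t₀, T) × ℝ`. Then `A ≥ a₀ > 0` on `[t₀, T) × ℝ`. (At a
minimiser of `A(t, ·)` the term `∂ₛA·w` vanishes and `∂ₛw` is bounded on the compact
`[t₀, T] × [0, L]` because `w` is `C¹` up to `t = T`; Grönwall for the period minimum, run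
backwards in time with Mathlib's `le_gronwallBound_of_liminf_deriv_right_le`.) -/
theorem coreLogGas_area_lower_bound {A w : ℝ → ℝ → ℝ} {L t₀ T S : ℝ} (hL : 0 < L)
    (ht₀T : t₀ < T) (hA : ContDiff ℝ 1 (uncurry A)) (hw : ContDiff ℝ 1 (uncurry w))
    (hperA : ∀ t, Periodic (A t) L) (hpos : ∀ t ∈ Ico t₀ T, ∀ s, 0 < A t s)
    (hres : ∀ t ∈ Ico t₀ T, ∀ s, |deriv (fun τ => A τ s) t + deriv (fun y => A t y) s * w t s +
      A t s * deriv (fun y => w t y) s| ≤ S * A t s) :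
    ∃ a₀ : ℝ, 0 < a₀ ∧ ∀ t ∈ Ico t₀ T, ∀ s, a₀ ≤ A t s := by
  -- a uniform bound `W` on `∂ₛ w` over `[t₀, T] × [0, L]`
  obtain ⟨C, hC⟩ : ∃ C, ∀ q ∈ Icc t₀ T ×ˢ Icc 0 L, ‖fderiv ℝ (uncurry w) q (0, 1)‖ ≤ C :=
    (isCompact_Icc.prod isCompact_Icc).exists_bound_of_continuousOn
      ((hw.continuous_fderiv one_ne_zero).clm_apply continuous_const).continuousOn
  set W : ℝ := max C 0 with hW
  have hws : ∀ t ∈ Icc t₀ T, ∀ s ∈ Icc 0 L, deriv (fun y => w t y) s ≤ W := by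
    intro t ht s hs
    rw [(coreLogGas_hasDerivAt_snd hw t s).deriv]
    have h1 := hC (t, s) ⟨ht, hs⟩
    rw [Real.norm_eq_abs] at h1
    exact ((le_abs_self _).trans h1).trans (le_max_left _ _)
  -- the minimum of `A (t, ·)` over a period, a continuous function of `t`
  set m : ℝ → ℝ := fun t => sInf (A t '' Icc 0 L) with hm
  have hmcont : Continuous m := isCompact_Icc.continuous_sInf hA.continuous
  -- minimisers: `m t = A t s₁` with `s₁ ∈ [0, L]` a global minimiser of `A (t, ·)` (periodicity)
  have hmin : ∀ t, ∃ s₁ ∈ Icc 0 L, m t = A t s₁ ∧ ∀ s, A t s₁ ≤ A t s := by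
    intro t
    have hc : Continuous (A t) :=
      hA.continuous.comp (continuous_const.prodMk continuous_id)
    obtain ⟨s₁, hs₁, hle⟩ := isCompact_Icc.exists_isMinOn (nonempty_Icc.2 hL.le) hc.continuousOn
    have hall : ∀ s, A t s₁ ≤ A t s := by
      intro s
      obtain ⟨y, hy, hys⟩ := (hperA t).exists_mem_Ico₀ hL s
      rw [hys]
      exact hle (Ico_subset_Icc_self hy)
    refine ⟨s₁, hs₁, ?_, hall⟩
    refine IsLeast.csInf_eq ⟨mem_image_of_mem _ hs₁, ?_⟩
    rintro _ ⟨s, -, rfl⟩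
    exact hall s
  have hm_le : ∀ t s, m t ≤ A t s := fun t s => by
    obtain ⟨s₁, -, h1, h2⟩ := hmin t
    rw [h1]
    exact h2 s
  -- Grönwall, backwards in time from `t₁`: `m t₀ ≤ m t₁ · exp (K₀ (t₁ - t₀))`
  set K₀ : ℝ := |S| + W with hK₀
  have hgron : ∀ t₁ ∈ Ico t₀ T, m t₀ ≤ m t₁ * Real.exp (K₀ * (t₁ - t₀)) := by
    intro t₁ ht₁
    set f : ℝ → ℝ := fun τ => m (t₁ - τ) with hf
    have hfc : ContinuousOn f (Icc 0 (t₁ - t₀)) :=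
      (hmcont.comp (continuous_const.sub continuous_id)).continuousOn
    have key := le_gronwallBound_of_liminf_deriv_right_le (f := f) (f' := fun τ => K₀ * f τ)
      (δ := f 0) (K := K₀) (ε := 0) (a := 0) (b := t₁ - t₀) hfc ?_ le_rfl
      (fun x _ => by simp only [add_zero, le_refl])
    · have h1 := key (t₁ - t₀) ⟨sub_nonneg.2 ht₁.1, le_rfl⟩
      rw [gronwallBound_ε0, sub_zero] at h1
      simpa [hf] using h1
    -- the liminf of the right slopes of `f` at `τ` is at most `K₀ f τ`
    intro τ hτ r hr
    set t : ℝ := t₁ - τ with ht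
    have htI : t ∈ Ico t₀ T := ⟨by rw [ht]; linarith [hτ.2], by rw [ht]; linarith [hτ.1, ht₁.2]⟩
    have htI' : t ∈ Icc t₀ T := Ico_subset_Icc_self htI
    obtain ⟨s₁, hs₁, hms, hall⟩ := hmin t
    -- `∂ₛ A (t, s₁) = 0` at the global minimiser
    have hds : deriv (fun y => A t y) s₁ = 0 := by
      have hmin' : IsMinOn (fun y => A t y) univ s₁ := fun s _ => hall s
      exact (hmin'.isLocalMin univ_mem).deriv_eq_zero
    -- the time derivative `a' = ∂ₜ A (t, s₁)` and the residual bound at `(t, s₁)`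
    set a' : ℝ := fderiv ℝ (uncurry A) (t, s₁) (1, 0) with ha'
    have hdt : HasDerivAt (fun τ' => A τ' s₁) a' t := coreLogGas_hasDerivAt_fst hA t s₁
    have hres₁ := hres t htI s₁
    rw [hdt.deriv, hds, zero_mul, add_zero] at hres₁
    have hApos : 0 < A t s₁ := hpos t htI s₁
    have hbd : -a' ≤ K₀ * A t s₁ := by
      have h1 : -(a' + A t s₁ * deriv (fun y => w t y) s₁) ≤ S * A t s₁ :=
        (neg_le_abs _).trans hres₁
      have h2 : A t s₁ * deriv (fun y => w t y) s₁ ≤ A t s₁ * W :=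
        mul_le_mul_of_nonneg_left (hws t htI' s₁ hs₁) hApos.le
      have h3 : S * A t s₁ ≤ |S| * A t s₁ := mul_le_mul_of_nonneg_right (le_abs_self S) hApos.le
      rw [hK₀]
      nlinarith
    -- the comparison function `z ↦ A (t₁ - z, s₁)` has derivative `-a'` at `τ` and dominates `f`
    have hg : HasDerivAt (fun z => A (t₁ - z) s₁) (-a') τ := by
      have h1 : HasDerivAt (fun z : ℝ => t₁ - z) (-1) τ := (hasDerivAt_id' τ).const_sub t₁
      have h2 : HasDerivAt (fun τ' => A τ' s₁) a' (t₁ - τ) := hdt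
      have h3 := h2.comp τ h1
      simpa [Function.comp_def] using h3
    have hfτ : f τ = A t s₁ := hms
    have hr' : -a' < r := by
      refine lt_of_le_of_lt (hbd.trans ?_) hr
      rw [hfτ]
    have hev : ∀ᶠ z in 𝓝[>] τ, slope (fun z => A (t₁ - z) s₁) τ z < r :=
      (hg.hasDerivWithinAt (s := Ioi τ)).limsup_slope_le' (lt_irrefl τ) hr'
    have hev2 : ∀ᶠ z in 𝓝[>] τ, (z - τ)⁻¹ * (f z - f τ) < r := by
      filter_upwards [hev, self_mem_nhdsWithin] with z hz hzτ
      have hzτ' : 0 < z - τ := sub_pos.2 hzτ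
      rw [slope_def_field] at hz
      have hle : f z - f τ ≤ A (t₁ - z) s₁ - A (t₁ - τ) s₁ := by
        rw [hfτ, ht]
        exact sub_le_sub_right (hm_le _ _) _
      calc (z - τ)⁻¹ * (f z - f τ) ≤ (z - τ)⁻¹ * (A (t₁ - z) s₁ - A (t₁ - τ) s₁) :=
            mul_le_mul_of_nonneg_left hle (inv_nonneg.2 hzτ'.le)
        _ = (A (t₁ - z) s₁ - A (t₁ - τ) s₁) / (z - τ) := inv_mul_eq_div _ _
        _ < r := hz
    exact hev2.frequently
  -- conclusion
  obtain ⟨s₀, -, hms₀, -⟩ := hmin t₀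
  have hm₀ : 0 < m t₀ := by
    rw [hms₀]
    exact hpos t₀ ⟨le_rfl, ht₀T⟩ s₀
  have hK₀nn : 0 ≤ K₀ := add_nonneg (abs_nonneg S) (le_max_right _ _)
  refine ⟨m t₀ * Real.exp (-(K₀ * (T - t₀))), mul_pos hm₀ (Real.exp_pos _), fun t ht s => ?_⟩
  have h1 := hgron t ht
  have h2 : m t₀ * Real.exp (-(K₀ * (t - t₀))) ≤ m t := by
    have h3 := mul_le_mul_of_nonneg_right h1 (Real.exp_pos (-(K₀ * (t - t₀)))).le
    rwa [mul_assoc, ← Real.exp_add, add_neg_cancel, Real.exp_zero, mul_one] at h3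
  calc m t₀ * Real.exp (-(K₀ * (T - t₀))) ≤ m t₀ * Real.exp (-(K₀ * (t - t₀))) := by
        refine mul_le_mul_of_nonneg_left (Real.exp_le_exp.2 ?_) hm₀.le
        have : K₀ * (t - t₀) ≤ K₀ * (T - t₀) :=
          mul_le_mul_of_nonneg_left (by linarith [ht.2]) hK₀nn
        linarith
    _ ≤ m t := h2
    _ ≤ A t s := hm_le t s

/-- **`CoreReductionContinuation` holds** (route CoreLogGas, item stmt-NavierStokesRegularity-2090):
log-gas no-vacuum from the mass residual (`coreLogGas_area_lower_bound`) bounds the vorticity on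
`[t₀, T)`; Tao 2013 (`tao2011_hasBoundedSobolevNormsOn_holds`) puts the classical Leray–Hopf
solution from rapidly decaying data in the BKM class on closed slabs and bounds its vorticity on
`[0, max t₀ (T/2)]`; the Beale–Kato–Majda criterion (`beale_kato_majda_holds`) continues it past
`T`. Unconditional: no named fact is taken as a hypothesis. -/
theorem coreLogGas_coreReductionContinuation_proof :
    Summit.NavierStokesRegularity.NavierStokesRegularity.Theses.CoreLogGas.CoreReductionContinuation := by
  intro ν T hν hT u p hcl hLH hdec hyp
  obtain ⟨κ, L, K, t₀, F, S, A, w, hκ, hL, -, ht₀T, hA, hw, hper, hres, hcurl⟩ := hyp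
  -- Step 1: no vacuum, `A ≥ a₀ > 0` on `[t₀, T) × ℝ`
  obtain ⟨a₀, ha₀, hAa⟩ := coreLogGas_area_lower_bound hL ht₀T hA hw (fun t => (hper t).1)
    (fun t ht s => (hres t ht s).1) (fun t ht s => (hres t ht s).2.1)
  -- Step 2: the vorticity is bounded by `Ω` on `[t₀, T)`
  set Ω : ℝ := |K| * (κ / a₀) with hΩdef
  have hΩ : ∀ t ∈ Ico t₀ T, ∀ x, ‖curl (u t) x‖ ≤ Ω := by
    intro t ht x
    have hsup : (⨆ s, κ / A t s) ≤ κ / a₀ :=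
      ciSup_le fun s => div_le_div_of_nonneg_left hκ.le ha₀ (hAa t ht s)
    have hnn : 0 ≤ ⨆ s, κ / A t s :=
      Real.iSup_nonneg fun s => div_nonneg hκ.le (ha₀.le.trans (hAa t ht s))
    calc ‖curl (u t) x‖ ≤ K * ⨆ s, κ / A t s := hcurl t ht x
      _ ≤ |K| * ⨆ s, κ / A t s := mul_le_mul_of_nonneg_right (le_abs_self K) hnn
      _ ≤ |K| * (κ / a₀) := mul_le_mul_of_nonneg_left hsup (abs_nonneg K)
  -- Step 3: the BKM class on closed slabs (Tao 2013, Cor. 11.1)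
  have hslab : ∀ T₁ ∈ Ioo 0 T, HasBoundedSobolevNormsOn (Icc 0 T₁) u := by
    intro T₁ hT₁
    have hsol' : IsClassicalNSSolutionOn (Icc 0 T₁) ν 0 u p :=
      hcl.mono (Icc_subset_Ico_right hT₁.2) (uniqueDiffOn_Icc hT₁.1)
    have hEn' : ∃ C : ℝ≥0∞, C < ⊤ ∧ ∀ t ∈ Icc 0 T₁, ∫⁻ x, ‖u t x‖ₑ ^ 2 ≤ C :=
      ⟨_, ENNReal.ofReal_lt_top, fun t ht =>
        hLH.lintegral_enorm_sq_le hν.le ⟨ht.1, ht.2.trans hT₁.2.le⟩⟩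
    exact (tao2011_hasBoundedSobolevNormsOn.closedSlab tao2011_hasBoundedSobolevNormsOn_holds
      linfty_bound_of_hasBoundedSobolevNormsOn_holds ν T₁ hν hT₁.1 u p hsol' hEn' hdec).1
  have hreg : ∀ T'' < T, HasBoundedSobolevNormsOn (Icc 0 T'') u := by
    intro T'' hT''
    have h1 : max T'' (T / 2) ∈ Ioo 0 T :=
      ⟨lt_max_of_lt_right (by linarith), max_lt hT'' (by linarith)⟩
    exact (hslab _ h1).mono (Icc_subset_Icc_right (le_max_left _ _))
  -- Step 4: the vorticity is bounded on `[0, t₁]`, `t₁ = max t₀ (T/2)` (Sobolev imbedding)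
  set t₁ : ℝ := max t₀ (T / 2) with ht₁
  have ht₁I : t₁ ∈ Ioo 0 T := ⟨lt_max_of_lt_right (by linarith), max_lt ht₀T (by linarith)⟩
  obtain ⟨R₁, hR₁, hR₁b⟩ := exists_enorm_curl_le_of_hasBoundedSobolevNormsOn
    (fun t ht => hcl.contDiff_velocity ⟨ht.1, ht.2.trans_lt ht₁I.2⟩) (hslab t₁ ht₁I)
  -- Step 5: the BKM integral `∫₀ᵀ ‖curl u(t)‖_∞ dt` is finite
  have hbound : ∀ t ∈ Ioo 0 T, (⨆ x, ‖curl (u t) x‖ₑ) ≤ R₁ + ENNReal.ofReal Ω := by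
    intro t ht
    refine iSup_le fun x => ?_
    rcases le_or_gt t t₁ with h | h
    · exact (hR₁b t ⟨ht.1.le, h⟩ x).trans le_self_add
    · have htI : t ∈ Ico t₀ T := ⟨(le_max_left _ _).trans h.le, ht.2⟩
      calc ‖curl (u t) x‖ₑ = ENNReal.ofReal ‖curl (u t) x‖ := (ofReal_norm _).symm
        _ ≤ ENNReal.ofReal Ω := ENNReal.ofReal_le_ofReal (hΩ t htI x)
        _ ≤ R₁ + ENNReal.ofReal Ω := le_add_self
  have hfin : (∫⁻ t in Ioo 0 T, ⨆ x, ‖curl (u t) x‖ₑ) < ⊤ := by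
    calc (∫⁻ t in Ioo 0 T, ⨆ x, ‖curl (u t) x‖ₑ)
        ≤ ∫⁻ _ in Ioo 0 T, (R₁ + ENNReal.ofReal Ω) := setLIntegral_mono' measurableSet_Ioo hbound
      _ = (R₁ + ENNReal.ofReal Ω) * volume (Ioo (0 : ℝ) T) := setLIntegral_const _ _
      _ < ⊤ := by
          refine ENNReal.mul_lt_top (ENNReal.add_lt_top.2 ⟨hR₁, ENNReal.ofReal_lt_top⟩) ?_
          rw [Real.volume_Ioo]
          exact ENNReal.ofReal_lt_top
  -- Step 6: Beale–Kato–Majda continues the solution in the class, hence smoothly, past `T`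
  exact ((beale_kato_majda_holds hν.le hT hcl hreg).2 hfin).hasSmoothExtensionPast

end Summit.NavierStokesRegularity.NavierStokesRegularity.Theorems

end
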